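import Literature.NumberTheory.Automorphic.UnitaryThreeTorusLatticeBridge        -- ★ p841371 (bridge lemmas; ★ γ1)
import Literature.NumberTheory.LocalFields.UnramifiedQuadraticOrderUnitIndex     -- ★ p840757 (F3a): `[Rˣ : U_j] = q^{j−1}(q+1)`
import HarnessLib

/-!
# The norm-one group `E¹` through the bridge: `u ↦ u ∕ σu` maps `Rˣ` ONTO `E¹` (Hilbert 90 with a UNIT) and `[E¹ : E¹ ∩ (1 + 𝔪^j)] = [Rˣ : U_j]`
(Flicker (1998), *Elementary proof of the fundamental lemma for a unitary group*, Prop. 6 (c) p. 83: `(r_j)⁻¹T_H r_j ∩ K_H ≅ (R + π^jR_E)^× ∕ R^× × E¹`;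
Prop. 7 p. 84: the index `[R_E^× : R_E(j)^×] = q^{j−1}(q+1)`)

Topic `NumberTheory/Automorphic`; namespace `Literature.NumberTheory.Automorphic.UnitaryGroup.TorusBridge`.  KERNEL mathematics only: theorems, no
definition, no named fact, no instance, no notation, no `sorry`.  Cell `pub/hodgecm-mathlib`, programme P3a, road «D-N7-inert», MAP v3 «N7-ns COUNT FROM
FLICKER», brick (F3c-γ) «LATTICE ↔ COSET TRANSPORT» FILE γ3b (the `E¹`-side of the WEIGHT; LEAD F0P3a-plan (g9) T8-60 (C); consumer B-p04 (g33) 05:34:35Z: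
the per-`i` factor `relIndex = if 2i+ε = 0 then 1 else (q+1)q^{2i+ε−1}` of ★ p841447).  HC_CM is proved only modulo the printed citations (2 remaining named
inputs hLiu418, h413) until rung 0 closes; this file discharges no named fact.

MATHEMATICS (bridge `(R, ι, hιv, σR, hσι)` as in ★ `UnitaryThreeTorusLatticeBridge`; `|2| = 1`, `|σx| = |x|`).  The homomorphism
**`g := Units.map ι ∕ Units.map (σ ∘ ι) : Rˣ →* Kˣ`, `u ↦ ι u ∕ σ(ι u)`** (§1): its values are NORM-ONE (`x·σx = 1`); conversely every norm-one `μ` is `g u`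
for a unit `u` (HILBERT 90 WITH A UNIT: one of `1 + μ`, `1 − μ` has valuation `1` since `|2| = 1`) — `range g = E¹`; its kernel is `(R^σ)ˣ`; and
**`|g u − 1| ≤ |ϖ|^j ⟺ σR u − u ∈ 𝔪^j ⟺ u ∈ U_j`** (★ `mem_comap_eqLocus_iff`), so `g⁻¹(E¹ ∩ (1 + 𝔪^j)) = U_j` and (§2)
**`[E¹ : E¹_j] = [Rˣ : U_j]`** — `= q^{j−1}(q+1)` for `j ≥ 1`, `= 1` for `j = 0` (★ `index_comap_eqLocus_eq` ∕ `_zero`), stated on `range g` with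
`E¹_j := (U_j).map g.rangeRestrict` (no new definition).

References: [Flicker1998UnitaryFL] Y. Z. Flicker, Canad. J. Math. 50 (1998), Prop. 6 (c) p. 83, Prop. 7 p. 84 · [Serre1979] J.-P. Serre, *Local Fields*, Ch. V §2
Prop. 2–3 (units of an unramified extension, Hilbert 90). -/

set_option autoImplicit false

open scoped WithZero

namespace Literature.NumberTheory.Automorphic.UnitaryGroup

namespace TorusBridge

open IsLocalRing Literature.NumberTheory.LocalFields.UnramifiedQuadraticNorm

universe u

/-- In `ℤᵐ⁰`: `x·x = 1 ⇒ x = 1`. [folklore] -/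
private theorem eq_one_of_mul_self' {x : ℤᵐ⁰} (h : x * x = 1) : x = 1 := by
  have hx0 : x ≠ 0 := fun h0 => by rw [h0, zero_mul] at h; exact zero_ne_one h
  rw [← WithZero.exp_log hx0, ← WithZero.exp_add, ← WithZero.exp_zero, WithZero.exp_inj] at h
  rw [← WithZero.exp_log hx0, ← WithZero.exp_zero, WithZero.exp_inj]; omega

variable {K : Type*} [Field K] [Valued K ℤᵐ⁰] (σ : K →+* K)
  {R : Type u} [CommRing R] (ι : R →+* K) (hι : Function.Injective ι)
  (hιv : ∀ x : K, Valued.v x ≤ 1 ↔ x ∈ Set.range ι) (σR : R →+* R) (hσι : ∀ r, ι (σR r) = σ (ι r))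

/-! ## §1 The map `u ↦ ι u ∕ σ(ι u)` -/

omit [Valued K ℤᵐ⁰] in
/-- The value of `g = Units.map ι ∕ Units.map (σ∘ι)` at `u`: `ι u ∕ σ(ι u)` (as an element of `K`). [cite: Serre1979, Ch. V §2 Prop. 3] -/
theorem coe_normOneMap_apply (u : Rˣ) :
    (((Units.map (ι : R →* K) / Units.map ((σ : K →* K).comp (ι : R →* K)) : Rˣ →* Kˣ) u : Kˣ) : K) = ι u / σ (ι u) := by
  rw [MonoidHom.div_apply, Units.val_div_eq_div_val, Units.coe_map, Units.coe_map]
  rfl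

omit [Valued K ℤᵐ⁰] in
include hι in
/-- The values are norm-one: `x · σx = 1` for `x = ι u ∕ σ(ι u)`. [cite: Serre1979, Ch. V §2 Prop. 3] -/
theorem normOneMap_mul_map [Nontrivial R] (hσσ : ∀ x, σ (σ x) = x) (u : Rˣ) :
    (ι u / σ (ι u)) * σ (ι u / σ (ι u)) = 1 := by
  have h0 : ι (u : R) ≠ 0 := fun h => (Units.ne_zero u) (hι (by rw [h, map_zero]))
  have h1 : σ (ι u) ≠ 0 := (map_ne_zero σ).2 h0
  rw [map_div₀, hσσ]; field_simp

include hι hιv in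
/-- An element of `R` whose image has valuation `1` is a unit. [cite: Serre1979, Ch. V §2 Prop. 2] -/
theorem isUnit_of_v_eq_one {r : R} (hr : Valued.v (ι r) = 1) : IsUnit r := by
  have h0 : ι r ≠ 0 := fun h => by rw [h, map_zero] at hr; exact zero_ne_one hr
  obtain ⟨s, hs⟩ := (hιv (ι r)⁻¹).1 (by rw [map_inv₀, hr, inv_one])
  exact isUnit_iff_exists_inv.2 ⟨s, hι (by rw [map_mul, hs, mul_inv_cancel₀ h0, map_one])⟩

include hι hιv in
/-- **HILBERT 90 WITH A UNIT**: if `μ·σμ = 1` then `μ = ι u ∕ σ(ι u)` for some `u ∈ Rˣ` — with `l := 1 + μ` or `l := 1 − μ` (one of them has valuation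
`1` because `|2| = 1`; both satisfy `μ·σl = ±l`… precisely `μ σ(1+μ) = 1+μ` and `μ σ(1−μ) = −(1−μ)`, and `−1 = ι(−1)∕σι(−1)`-free since `σ(−l) = −σl`).
[cite: Serre1979, Ch. V §2 Prop. 3] [cite: Flicker1998UnitaryFL, Prop. 6 p. 83] -/
theorem exists_unit_normOneMap_eq (hvσ : ∀ x, Valued.v (σ x) = Valued.v x) (h2 : Valued.v (2 : K) = 1)
    {d : K} (hd : σ d = -d) (hvd : Valued.v d = 1) {μ : K} (hμ : μ * σ μ = 1) : ∃ u : Rˣ, ι u / σ (ι u) = μ := by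
  have hμ0 : μ ≠ 0 := fun h => by rw [h, zero_mul] at hμ; exact zero_ne_one hμ
  have hd0 : d ≠ 0 := fun h => by rw [h, map_zero] at hvd; exact zero_ne_one hvd
  have hvμ : Valued.v μ = 1 := by
    have h1 := congrArg Valued.v hμ
    rw [map_mul, hvσ, map_one] at h1
    exact eq_one_of_mul_self' h1
  -- one of `1 + μ`, `1 − μ` has valuation `1`
  have hle1 : Valued.v (1 + μ) ≤ 1 := Valuation.map_add_le _ (by rw [map_one]) hvμ.le
  have hle2 : Valued.v (1 - μ) ≤ 1 := Valuation.map_sub_le _ (by rw [map_one]) hvμ.le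
  have hone : Valued.v (1 + μ) = 1 ∨ Valued.v (1 - μ) = 1 := by
    by_cases hA : Valued.v (1 + μ) = 1
    · exact Or.inl hA
    · right
      by_contra hB
      have hlt1 : Valued.v (1 + μ) < 1 := lt_of_le_of_ne hle1 hA
      have hlt2 : Valued.v (1 - μ) < 1 := lt_of_le_of_ne hle2 hB
      have : Valued.v ((1 + μ) + (1 - μ)) < 1 := Valuation.map_add_lt _ hlt1 hlt2
      rw [show (1 + μ) + (1 - μ) = (2 : K) by ring, h2] at this
      exact lt_irrefl _ this
  rcases hone with h1 | h1
  · -- `l = 1 + μ`: `μ σl = l`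
    obtain ⟨l, hl⟩ := (hιv (1 + μ)).1 h1.le
    have hu : IsUnit l := isUnit_of_v_eq_one ι hι hιv (by rw [hl, h1])
    refine ⟨hu.unit, ?_⟩
    rw [IsUnit.unit_spec, hl, map_add, map_one]
    have hd' : 1 + σ μ ≠ 0 := by
      intro h0; have : Valued.v (σ (1 + μ)) = 0 := by rw [map_add, map_one, h0, map_zero]
      rw [hvσ, h1] at this; exact one_ne_zero this
    rw [div_eq_iff hd']; linear_combination -hμ
  · -- `l = d (1 − μ)`: `μ σl = l`
    have h1' : Valued.v (d * (1 - μ)) = 1 := by rw [map_mul, hvd, h1, one_mul]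
    obtain ⟨l, hl⟩ := (hιv (d * (1 - μ))).1 h1'.le
    have hu : IsUnit l := isUnit_of_v_eq_one ι hι hιv (by rw [hl, h1'])
    refine ⟨hu.unit, ?_⟩
    rw [IsUnit.unit_spec, hl, map_mul, hd, map_sub, map_one]
    have hd' : -d * (1 - σ μ) ≠ 0 := by
      refine mul_ne_zero (neg_ne_zero.2 hd0) ?_
      intro h0; have : Valued.v (σ (1 - μ)) = 0 := by rw [map_sub, map_one, h0, map_zero]
      rw [hvσ, h1] at this; exact one_ne_zero this
    rw [div_eq_iff hd']; linear_combination (-d) * hμ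

include hι hιv hσι in
/-- **`|ι u ∕ σ(ι u) − 1| ≤ |ϖ^j| ⟺ σR u − u ∈ 𝔪^j`** (`ϖ = ι ϖR` a uniformiser, `u` a unit): the preimage of `E¹ ∩ (1 + 𝔪^j)` under `u ↦ u∕σu` is the
subgroup `U_j = {u : u ≡ σu (𝔪^j)}` of ★ `UnramifiedQuadraticOrderUnitIndex`. [cite: Flicker1998UnitaryFL, Prop. 6 (c) p. 83] -/
theorem v_normOneMap_sub_one_le_iff [IsDomain R] [IsDiscreteValuationRing R] (hvσ : ∀ x, Valued.v (σ x) = Valued.v x)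
    {ϖR : R} (hϖR : Irreducible ϖR) (j : ℕ) (u : Rˣ) :
    Valued.v (ι u / σ (ι u) - 1) ≤ Valued.v (ι ϖR ^ j) ↔ σR (u : R) - u ∈ maximalIdeal R ^ j := by
  have h0 : ι (u : R) ≠ 0 := fun h => (Units.ne_zero u) (hι (by rw [h, map_zero]))
  have h1 : σ (ι u) ≠ 0 := (map_ne_zero σ).2 h0
  have hvu : Valued.v (σ (ι u)) = 1 := by rw [hvσ]; exact v_eq_one_of_isUnit ι hιv (Units.isUnit u)
  have e1 : ι u / σ (ι u) - 1 = -(ι (σR u - u)) / σ (ι u) := by rw [map_sub, hσι]; field_simp; ring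
  rw [e1, map_div₀, Valuation.map_neg, hvu, div_one, Irreducible.maximalIdeal_eq hϖR, Ideal.span_singleton_pow, Ideal.mem_span_singleton]
  constructor
  · intro h
    by_cases hj : σR (u : R) - u = 0
    · rw [hj]; exact dvd_zero _
    have hne : ι (ϖR ^ j) ≠ 0 := by
      rw [map_pow]; exact pow_ne_zero _ fun h0' => hϖR.ne_zero (hι (by rw [h0', map_zero]))
    obtain ⟨y, hy⟩ := (hιv (ι (σR u - u) / ι (ϖR ^ j))).1 (by
      rw [map_div₀, map_pow ι]; exact div_le_one_of_le₀ h zero_le)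
    refine ⟨y, hι ?_⟩
    rw [map_mul, hy, mul_div_cancel₀ _ hne]
  · rintro ⟨y, hy⟩
    rw [hy, map_mul, map_mul, map_pow ι]
    exact mul_le_of_le_one_right zero_le (v_le_one ι hιv y)

/-! ## §2 The index transfer `[E¹ : E¹ ∩ (1+𝔪^j)] = [Rˣ : U_j]` -/

include hι hιv hσι in
/-- **THE WEIGHT TRANSFER**: for ANY group `G` with a homomorphism `f : G →* Kˣ` whose values are norm-one (`f x · σ(f x) = 1`) and which reaches
every `ι u ∕ σ(ι u)` (`u ∈ Rˣ`), the subgroup `S = {x : |f x − 1| ≤ |ϖ|^j}` has index **`[G : S] = [Rˣ : U_j]`**, `U_j = {u : σu ≡ u (𝔪^j)}` the subgroup of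
★ `UnramifiedQuadraticOrderUnitIndex` (so `= q^{j−1}(q+1)` for `j ≥ 1` by ★ `index_comap_eqLocus_eq`, `= 1` for `j = 0`).  Used at `G := T_H^θ = Z_H(t_θ)`,
`f := τ ↦ μ₊∕μ₋` (γ3a).  [cite: Flicker1998UnitaryFL, Prop. 6 (c) p. 83, Prop. 7 p. 84] -/
theorem index_eq_index_units_of_normOne [IsDomain R] [IsDiscreteValuationRing R] (hσR : ∀ r, σR (σR r) = r)
    (hvσ : ∀ x, Valued.v (σ x) = Valued.v x) (h2 : Valued.v (2 : K) = 1) {d : K} (hd : σ d = -d) (hvd : Valued.v d = 1)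
    {ϖR : R} (hϖR : Irreducible ϖR) {G : Type*} [Group G] (f : G →* Kˣ)
    (hf : ∀ x, ((f x : Kˣ) : K) * σ ((f x : Kˣ) : K) = 1) (hfs : ∀ u : Rˣ, ∃ x, ((f x : Kˣ) : K) = ι u / σ (ι u))
    (S : Subgroup G) (j : ℕ) (hS : ∀ x, x ∈ S ↔ Valued.v (((f x : Kˣ) : K) - 1) ≤ Valued.v (ι ϖR ^ j)) :
    S.index = (((Units.map (Ideal.quotientMap (maximalIdeal R ^ j) σR (maximalIdeal_pow_le_comap σR hσR j)).toMonoidHom).eqLocus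
      (MonoidHom.id _)).comap (Units.map (Ideal.Quotient.mk (maximalIdeal R ^ j)).toMonoidHom)).index := by
  classical
  -- the norm-one map `g` and its range
  set g : Rˣ →* Kˣ := Units.map (ι : R →* K) / Units.map ((σ : K →* K).comp (ι : R →* K)) with hg
  have hgv : ∀ u : Rˣ, ((g u : Kˣ) : K) = ι u / σ (ι u) := fun u => coe_normOneMap_apply σ ι u
  set U : Subgroup Rˣ := ((Units.map (Ideal.quotientMap (maximalIdeal R ^ j) σR (maximalIdeal_pow_le_comap σR hσR j)).toMonoidHom).eqLocus (MonoidHom.id _)).comap (Units.map (Ideal.Quotient.mk (maximalIdeal R ^ j)).toMonoidHom) with hU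
  have hUmem : ∀ u : Rˣ, u ∈ U ↔ σR (u : R) - u ∈ maximalIdeal R ^ j := fun u => mem_comap_eqLocus_iff σR hσR j u
  -- `f` lands in `range g` (Hilbert 90 with a unit) and is onto it
  have hfr : ∀ x, f x ∈ g.range := by
    intro x
    obtain ⟨u, hu⟩ := exists_unit_normOneMap_eq σ ι hι hιv hvσ h2 hd hvd (hf x)
    exact ⟨u, Units.ext (by rw [hgv, hu])⟩
  let f' : G →* ↥g.range := f.codRestrict g.range hfr
  have hf'v : ∀ x, (((f' x : ↥g.range) : Kˣ) : K) = ((f x : Kˣ) : K) := fun _ => rfl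
  have hgr : ∀ u : Rˣ, (((g.rangeRestrict u : ↥g.range) : Kˣ) : K) = ι u / σ (ι u) := fun u => by
    rw [MonoidHom.coe_rangeRestrict, hgv]
  have hf's : Function.Surjective f' := by
    intro y
    obtain ⟨u, hu⟩ := MonoidHom.mem_range.1 y.2
    obtain ⟨x, hx⟩ := hfs u
    refine ⟨x, Subtype.ext (Units.ext ?_)⟩
    rw [hf'v, hx, ← hgv, hu]
  -- `S = (U.map g.rangeRestrict).comap f'`
  have hSeq : S = (U.map g.rangeRestrict).comap f' := by
    ext x
    rw [hS, Subgroup.mem_comap, Subgroup.mem_map]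
    constructor
    · intro hx
      obtain ⟨u, hu⟩ := exists_unit_normOneMap_eq σ ι hι hιv hvσ h2 hd hvd (hf x)
      refine ⟨u, ?_, Subtype.ext (Units.ext ?_)⟩
      · rw [hUmem, ← v_normOneMap_sub_one_le_iff σ ι hι hιv σR hσι hvσ hϖR j u, hu]
        exact hx
      · rw [hgr, hf'v, hu]
    · rintro ⟨u, huU, hux⟩
      have hval : ι u / σ (ι u) = ((f x : Kˣ) : K) := by rw [← hgr u, ← hf'v x, hux]
      rw [← hval, v_normOneMap_sub_one_le_iff σ ι hι hιv σR hσι hvσ hϖR j u]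
      exact (hUmem u).1 huU
  -- indices
  have hker : g.rangeRestrict.ker ≤ U := by
    intro u hu
    rw [MonoidHom.mem_ker] at hu
    have h1 : ι u / σ (ι u) = 1 := by rw [← hgr u, hu]; rfl
    have h0 : σ (ι u) ≠ 0 := (map_ne_zero σ).2 fun h => (Units.ne_zero u) (hι (by rw [h, map_zero]))
    rw [div_eq_one_iff_eq h0, ← hσι] at h1
    have h3 : σR (u : R) - u = 0 := by rw [← hι h1, sub_self]
    rw [hUmem, h3]
    exact Ideal.zero_mem _
  rw [hSeq, Subgroup.index_comap_of_surjective _ hf's, Subgroup.index_map, MonoidHom.range_eq_top_of_surjective _ (MonoidHom.rangeRestrict_surjective g),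
    Subgroup.index_top, mul_one, sup_eq_left.2 hker]

end TorusBridge

end Literature.NumberTheory.Automorphic.UnitaryGroup
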